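import Summits.AnomalousDissipation.AnomalousDissipation.Theses.LandauJetArena
import HarnessLib

/-!
# Route LandauJetArena — the assembly `Assembly`

Proof of the route declaration
`Summit.AnomalousDissipation.AnomalousDissipation.Theses.LandauJetArena.Assembly`
(item stmt-AnomalousDissipation-1541): the route target X (the zeroth law restricted to push–pull
jet-pair forces on `T³`, i.e. the body of `JetPairZerothLaw`) implies the problem statement
`AnomalousDissipation = Literature.Turb.ZerothLaw`.

This is pure bookkeeping: unpack the witness `(ρ, a, φ, f)` with its family `(ν, u₀, u)`, the
energy bound `E` and the dissipation floor `ε`; discard every jet-pair clause except `IsSmooth f`,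
`IsDivFree f`, `HasZeroMean f`; repack into `Literature.Turb.ZerothLaw` with the anonymous
constructor. It is the same term as the route's planner-authored deciding theorem
`…Theses.LandauJetArena.closes` (D-0027 §2.1), written out self-contained so that it does not
depend on the name of that theorem.
-/

namespace Summit.AnomalousDissipation.AnomalousDissipation.Theorems

-- the mandated namespace `Summit.<Summit>.<Problem>.Theorems` repeats `AnomalousDissipation` (single-problem summit)
set_option linter.dupNamespace false

open Summit.AnomalousDissipation.AnomalousDissipation.Theses.LandauJetArena

/-- **Assembly of route `LandauJetArena`** (item stmt-AnomalousDissipation-1541):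
X → `AnomalousDissipation`, where X is the jet-pair zeroth law (body of `JetPairZerothLaw`).
Unpack X, keep only `IsSmooth f`, `IsDivFree f`, `HasZeroMean f` from the jet-pair clauses, and
repack the family `(ν, u₀, u)`, the energy bound and the dissipation floor into
`Literature.Turb.ZerothLaw` (to which `AnomalousDissipation` unfolds). Closes item
stmt-AnomalousDissipation-1541. [route AnomalousDissipation/LandauJetArena; folklore bookkeeping] -/
theorem landauJetArena_assembly_proof :
    Summit.AnomalousDissipation.AnomalousDissipation.Theses.LandauJetArena.Assembly := by
  unfold Assembly
  intro hX
  obtain ⟨ρ, a, φ, f, ⟨-, -, -, -, -, -, hfs, hfd, hfm, -⟩, ν, u₀, u, hν, hT, hLH, hE, ε, hε, hD⟩ :=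
    hX
  show Literature.Turb.ZerothLaw
  exact ⟨f, hfs, hfd, hfm, ν, u₀, u, hν, hT, hLH, hE, ε, hε, hD⟩

end Summit.AnomalousDissipation.AnomalousDissipation.Theorems
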